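import Literature.AlgebraicGeometry.HodgeTheory.SubvariationIrreducibleOfStabilizer
import Literature.AlgebraicGeometry.HodgeTheory.FlatSpanOfJetSpan
import HarnessLib

/-!
# The stabiliser condition (STAB)_s from a finite jet certificate at one member

Family `hodge`, layer `Literature/AlgebraicGeometry/HodgeTheory`; THEOREMS ONLY. Sister of
`FlatSpanOfJetSpan` (which reduces the rank-one flat-span condition (FS)_s to a jet-span statement):
here the hypothesis (STAB)_s of `isTransportIrreducible_of_stabilizer_scalar` ∕
`eq_bot_or_eq_of_stable_of_stabilizer_scalar` (`SubvariationIrreducibleOfStabilizer`) — «every endomorphism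
`φ` of `ℂ ⊗_ℚ Hᵏ(X_s; ℚ)` preserving `Mi` and every pulled-back `Mi ∩ F^p(X_t)` is a scalar on `Mi`» — is
reduced to a FINITE LINEAR statement at ONE member `s`, the shape an exact computation can certify for ANY
Hodge number `dim(Mi ∩ F^p)` (the cell's (C37) «STAB-JET», memo `ROUTE-P3v28-g37.md` §7; needed for the
degree parameter `e ≥ 6` of crux K1Q, where the rank-one engine does not apply).

DATA at `s`, in a chart `ψ` of the base with an open `W₀ ∋ s` in its source: a family of vectors
`ω z i ∈ ℂ ⊗_ℚ Hᵏ(X_s; ℚ)` and a family of linear functionals `η z l` (`z ∈ ℂ^d`), such that at every member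
`t ∈ W₀` reached inside `W₀` (rational transport `T`): `ω (ψ t) i ∈ Mi ∩ F^p(t,T)` and `η (ψ t) l` kills
`Mi ∩ F^p(t,T)` (in the application: frames of `M ∩ F²(X_t)` and of its annihilator, from Griffiths residues).
JET STABILISER: every `φ` preserving `Mi` for which all the scalar functions `z ↦ η z l (φ (ω z i))` have
vanishing iterated derivatives of order `≤ r` at `ψ s` is a scalar on `Mi` (a finite linear system on `φ` once
the jets of `ω` and `η` at `ψ s` are known). THEN (STAB)_s holds (`stabilizer_scalar_of_jetStabilizer`): for a
`φ` preserving `Mi` and all `Mi ∩ F^p(t,T)`, each `η z l (φ (ω z i))` vanishes identically on a ball around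
`ψ s` (members reached along chart images of segments, as in `flatSpan_of_jetSpan`; a rational transport along
the segment exists, `exists_ratTransport`), so its derivatives vanish (`Filter.EventuallyEq.iteratedFDeriv`).
No analyticity is assumed; no named fact.

## References
* [VoisinHodgeI2002] C. Voisin, Hodge Theory and Complex Algebraic Geometry I, CUP 2002, §10.2.1–10.2.3
  (infinitesimal study of the period map).
* [Deligne1987] P. Deligne, Un théorème de finitude pour la monodromie, Progr. Math. 67 (1987), §1.12–1.13.
-/

noncomputable section

open CategoryTheory AlgebraicGeometry
open _root_.Topology _root_.Filter Set Module Submodule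
open scoped TensorProduct
open Literature.AlgebraicTopology.SingularHomology
open Literature.AlgebraicGeometry.Motives

namespace Literature.AlgebraicGeometry.HodgeTheory

section HodgeTheory

variable {𝒳 S : SchemeOver ℂ}

/-- **(STAB)_s from a jet-stabiliser certificate** (see the module docstring). [cite: VoisinHodgeI2002, §10.2.3]
[cite: Deligne1987, §1.12–1.13 (p. 10–11)] -/
theorem stabilizer_scalar_of_jetStabilizer (f : 𝒳 ⟶ S) (n k d : ℕ) (hf : IsSmoothProjectiveFamily f n)
    (hS : IsQuasiProjectiveOver S) [AlgebraicGeometry.SmoothOfRelativeDimension d S.hom]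
    (hU : IsCohomologicallyLocallyTrivialOn f (Set.univ : Set (ComplexPoints S)))
    (A : ∀ t : ComplexPoints S, HodgeModel n (fiberOver f t)) (hA : ∀ t, (A t).IsHodgeSymmetric)
    (s : (Set.univ : Set (ComplexPoints S)))
    (Mi : Submodule ℂ (ℂ ⊗[ℚ] bettiCohomology (fiberOver f s.1) k)) (p : ℤ)
    (ψ : OpenPartialHomeomorph (Set.univ : Set (ComplexPoints S)) (Fin d → ℂ))
    (W₀ : Set (Set.univ : Set (ComplexPoints S))) (hW₀o : IsOpen W₀) (hsW₀ : s ∈ W₀)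
    (hW₀ψ : W₀ ⊆ ψ.source) {ι ι' : Type*}
    (ω : (Fin d → ℂ) → ι → ℂ ⊗[ℚ] bettiCohomology (fiberOver f s.1) k)
    (η : (Fin d → ℂ) → ι' → Module.Dual ℂ (ℂ ⊗[ℚ] bettiCohomology (fiberOver f s.1) k))
    (hω : ∀ t ∈ W₀, ∀ (ε : Path s t), (∀ r', ε r' ∈ W₀) →
      ∀ (T : bettiCohomology (fiberOver f s.1) k ≃ₗ[ℚ] bettiCohomology (fiberOver f t.1) k),
        (∀ v, ofRatClass _ k (T v) = transportFun f k hU ⟦ε⟧ (ofRatClass _ k v)) →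
        ∀ i, ω (ψ t) i ∈ Mi ⊓ (((A t.1).hodgeStructure (hf.isSmoothProjective t.1) (hA t.1) k).comapEquiv T).F p)
    (hη : ∀ t ∈ W₀, ∀ (ε : Path s t), (∀ r', ε r' ∈ W₀) →
      ∀ (T : bettiCohomology (fiberOver f s.1) k ≃ₗ[ℚ] bettiCohomology (fiberOver f t.1) k),
        (∀ v, ofRatClass _ k (T v) = transportFun f k hU ⟦ε⟧ (ofRatClass _ k v)) →
        ∀ l, ∀ x ∈ Mi ⊓ (((A t.1).hodgeStructure (hf.isSmoothProjective t.1) (hA t.1) k).comapEquiv T).F p,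
          η (ψ t) l x = 0)
    (r : ℕ)
    (hjet : ∀ φ : (ℂ ⊗[ℚ] bettiCohomology (fiberOver f s.1) k) →ₗ[ℂ] (ℂ ⊗[ℚ] bettiCohomology (fiberOver f s.1) k),
      (∀ x ∈ Mi, φ x ∈ Mi) →
      (∀ i l, ∀ m ≤ r, iteratedFDeriv ℂ m (fun z ↦ η z l (φ (ω z i))) (ψ s) = 0) →
      ∃ c : ℂ, ∀ x ∈ Mi, φ x = c • x) :
    ∀ φ : (ℂ ⊗[ℚ] bettiCohomology (fiberOver f s.1) k) →ₗ[ℂ] (ℂ ⊗[ℚ] bettiCohomology (fiberOver f s.1) k),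
      (∀ x ∈ Mi, φ x ∈ Mi) →
      (∀ (t : (Set.univ : Set (ComplexPoints S))) (γ : Path.Homotopic.Quotient s t)
        (T : bettiCohomology (fiberOver f s.1) k ≃ₗ[ℚ] bettiCohomology (fiberOver f t.1) k),
        (∀ v, ofRatClass _ k (T v) = transportFun f k hU γ (ofRatClass _ k v)) →
        ∀ x ∈ Mi ⊓ (((A t.1).hodgeStructure (hf.isSmoothProjective t.1) (hA t.1) k).comapEquiv T).F p,
          φ x ∈ (((A t.1).hodgeStructure (hf.isSmoothProjective t.1) (hA t.1) k).comapEquiv T).F p) →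
      ∃ c : ℂ, ∀ x ∈ Mi, φ x = c • x := by
  intro φ hφM hφF
  apply hjet φ hφM
  -- rational transports exist along every path class (smooth projective family over a smooth base)
  have hrat : ∀ (a b : (Set.univ : Set (ComplexPoints S))) (γ : Path.Homotopic.Quotient a b)
      (α : complexBetti (fiberOver f a.1) k),
      IsRationalClass α → IsRationalClass (transportFun f k hU γ α) :=
    fun _ _ γ _ hα ↦ isRationalClass_transportFun_of_isSmoothProjectiveFamily (f := f) (k := k) d hf hS γ hα
  -- a ball around `ψ s` inside `ψ(W₀)`
  have hs_src : s ∈ ψ.source := hW₀ψ hsW₀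
  have hUo : IsOpen (ψ.target ∩ ψ.symm ⁻¹' W₀) := ψ.isOpen_inter_preimage_symm hW₀o
  have hψsU : ψ s ∈ ψ.target ∩ ψ.symm ⁻¹' W₀ := by
    refine ⟨ψ.map_source hs_src, ?_⟩
    rw [mem_preimage, ψ.left_inv hs_src]
    exact hsW₀
  obtain ⟨δ, hδ, hball⟩ := Metric.isOpen_iff.1 hUo (ψ s) hψsU
  -- each scalar function `z ↦ η z l (φ (ω z i))` vanishes on the ball
  have hzero : ∀ i l, ∀ z ∈ Metric.ball (ψ s) δ, η z l (φ (ω z i)) = 0 := by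
    intro i l z hz
    have hzU := hball hz
    have hBpc : IsPathConnected (Metric.ball (ψ s) δ) :=
      (convex_ball (ψ s) δ).isPathConnected ⟨ψ s, Metric.mem_ball_self hδ⟩
    have himg : IsPathConnected (ψ.symm '' Metric.ball (ψ s) δ) :=
      hBpc.image' (ψ.continuousOn_symm.mono fun z' hz' ↦ (hball hz').1)
    have hs' : s ∈ ψ.symm '' Metric.ball (ψ s) δ := ⟨ψ s, Metric.mem_ball_self hδ, ψ.left_inv hs_src⟩
    have ht' : ψ.symm z ∈ ψ.symm '' Metric.ball (ψ s) δ := ⟨z, hz, rfl⟩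
    have hjoin : JoinedIn (ψ.symm '' Metric.ball (ψ s) δ) s (ψ.symm z) := himg.joinedIn s hs' _ ht'
    have hεW₀ : ∀ r', hjoin.somePath r' ∈ W₀ := fun r' ↦ by
      obtain ⟨z', hz', hz'eq⟩ := hjoin.somePath_mem r'
      rw [← hz'eq]
      exact (hball hz').2
    obtain ⟨T, hT⟩ := exists_ratTransport f k hU hrat (⟦hjoin.somePath⟧ : Path.Homotopic.Quotient s (ψ.symm z))
    have hωt := hω (ψ.symm z) hzU.2 hjoin.somePath hεW₀ T hT i
    have hφt := hφF (ψ.symm z) ⟦hjoin.somePath⟧ T hT _ hωt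
    have hηt := hη (ψ.symm z) hzU.2 hjoin.somePath hεW₀ T hT l (φ (ω (ψ (ψ.symm z)) i))
      ⟨hφM _ hωt.1, hφt⟩
    rwa [ψ.right_inv hzU.1] at hηt
  -- hence all their derivatives at `ψ s` vanish
  intro i l m _
  have hev : (fun z ↦ η z l (φ (ω z i))) =ᶠ[𝓝 (ψ s)] fun _ ↦ (0 : ℂ) :=
    Filter.eventuallyEq_of_mem (Metric.ball_mem_nhds (ψ s) hδ) (hzero i l)
  rw [(hev.iteratedFDeriv ℂ m).self_of_nhds, iteratedFDeriv_fun_zero]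
  rfl

end HodgeTheory

end Literature.AlgebraicGeometry.HodgeTheory

end
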